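import Literature.Claims.NS.Dou2026b
import Literature.Analysis.FluidPDE.NSSuitableESSRefutation
import Mathlib.Analysis.Calculus.Deriv.Shift
import HarnessLib

/-!
# C54b `Dou2026b` — refuter-3's kernel facts about the landed skeleton (p481603)

Text of record: Hua-Shu Dou, «Non-Existence of Global Smooth Solutions to the 3D Navier–Stokes
Equations in a Periodic Domain with Prescribed Body Force», Preprints.org 202606.0089 v1 (2026),
printed page N = PDF page N+1. Skeleton `Literature.Claims.NS.Dou2026b` (typist-3 g2, p481603).
The Step 2 / vacuity / Couette blocks below are ADOPTED from typist-3 g2's kill kit v2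
(`claims/Dou2026b/typist3-killkit-SoloRefuteDou2026b.lean`, sha16 6338b373dad32c38) after an
independent farm check; the Step 4e block is added here.

* `not_Step2_dataInClass : ¬ Step2_dataInClass` — EARLIEST ON-PATH STEP. The printed property 4
  («u₀ ∈ H³_{σ,per}(Ω)», §3.2.1 print p.5, with the periodic boundary condition (3) print p.3 and
  the embedding (8) `H³ ↪ C¹` print p.4) fails for the paper's own worked case `a = 1, b = 1/5,
  h = 1` (eq. (27) print p.9): the profile (13) with `h₁ = 1.1h` is even in `y` with non-zero slope
  at `y = ±h`, so it has no `2h`-periodic `C¹` extension off `(−h, h)` (NS-free calculus).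
* `claimedTheorem_vacuous : ∀ Recr, ClaimedTheorem Recr` — VACUITY CERTIFICATE: Theorem 6.2
  (print p.12–13) as printed-and-typed holds for every threshold for the trivial reason that NO
  field of its class has the printed initial values (`dataInClass_of_solution` of the skeleton +
  the calculus above, for every `(a, b, h)` admitted by the printed property 3).
* `not_Step6_EVMP : ¬ Step6_EVMP`, `not_LocalVanishing : ¬ LocalVanishing` — the decisive printed
  proof step, Theorem 5.3 (EVMP) (28) ⇒ (29) via (30)–(33) print p.9–10, and Theorem 6.1 item 1
  (38) print p.11, in the generality their proofs argue, are false: plane Couette flow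
  `u(t,x) = x₁ e₀`, `p = 0`, `f = 0` is a steady classical solution with `νΔu + ⟨f,τ⟩τ = 0`
  everywhere and `u ≠ 0` off the plane `x₁ = 0`.
* `not_Step4e_pointwiseToH1 : ¬ Step4e_pointwiseToH1` — Theorem 5.1 proof item 5 print p.8
  («pointwise vanishing ⇒ local H¹-norm → 0») is false: `S(t,x) = x` vanishes at `x* = 0` while its
  `H¹(B_ε(0))`-energy is the positive constant `∫_{B_ε} (|x|² + 1) ≥ |B_ε|`.

WHAT THIS IS NOT: not a claim about NS regularity or blow-up; not a claim about any author beyond the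
typed locator.
-/

noncomputable section

open Set Filter
open scoped Topology Laplacian InnerProductSpace

-- the cell's Theorems namespace repeats the summit name (convention); silence the duplicate-namespace linter
set_option linter.dupNamespace false

namespace Summit.NavierStokesRegularity.NavierStokesRegularity.Theorems.Dou2026b

open Literature.Claims.NS.Dou2026b

/-- Under the printed property 3 (profile positive on `[−h, h]`) the slope of the datum's profile at
`y = h` is non-zero: `P′(h) = 0` would force `121a + 200b = 0`, and then positivity at `y = 0` and
at `y = h` give `b < 0` and `b > 0`. [cite: Dou2026b, eq. (13) and property 3 print p.5] -/
theorem slope_ne_zero {a b h : ℝ} (hh : 0 < h)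
    (hpos : ∀ y ∈ Icc (-h) h, 0 < profile a b (hOne h) y) :
    deriv (profile a b (hOne h)) h ≠ 0 := by
  rw [deriv_profile]
  intro hz
  have hne : h ≠ 0 := hh.ne'
  have p0 : 0 < a * (1 - (0 : ℝ) ^ 2 / (11 / 10 * h) ^ 2) + b * (1 - (0 : ℝ) ^ 4 / (11 / 10 * h) ^ 4) :=
    hpos 0 ⟨by linarith, by linarith⟩
  have p1 : 0 < a * (1 - h ^ 2 / (11 / 10 * h) ^ 2) + b * (1 - h ^ 4 / (11 / 10 * h) ^ 4) :=
    hpos h ⟨by linarith, le_rfl⟩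
  have q2 : h ^ 2 / (11 / 10 * h) ^ 2 = 100 / 121 := by field_simp; ring
  have q4 : h ^ 4 / (11 / 10 * h) ^ 4 = 10000 / 14641 := by field_simp; ring
  norm_num at p0
  rw [q2, q4] at p1
  have hz' : -(2 * a * h / (11 / 10 * h) ^ 2) - 4 * b * h ^ 3 / (11 / 10 * h) ^ 4 = 0 := hz
  have key : (121 * a + 200 * b) * (200 / (14641 * h)) = 0 := by
    have hid : -(2 * a * h / (11 / 10 * h) ^ 2) - 4 * b * h ^ 3 / (11 / 10 * h) ^ 4 =
        -((121 * a + 200 * b) * (200 / (14641 * h))) := by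
      field_simp; ring
    linarith [hid, hz']
  rcases mul_eq_zero.mp key with e1 | e2
  · linarith
  · have : (0 : ℝ) < 200 / (14641 * h) := by positivity
    linarith

/-- No 2h-periodic `C¹` function agrees with the profile on `(−h, h)` when the slope at `h` is
non-zero (the profile is even, so `P′(−h) = −P′(h)`; a periodic `C¹` extension forces `P′(h) =
P′(−h)`). [cite: Dou2026b, §3.2.1 property 4 print p.5 with (3) print p.3] -/
theorem no_periodicC1_extension {a b h : ℝ} (hh : 0 < h)
    (hslope : deriv (profile a b (hOne h)) h ≠ 0) :
    ¬ ∃ g : ℝ → ℝ, ContDiff ℝ 1 g ∧ (∀ y, g (y + 2 * h) = g y) ∧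
      ∀ y ∈ Ioo (-h) h, g y = profile a b (hOne h) y := by
  rintro ⟨g, hg, hper, heq⟩
  have hD : EqOn (deriv g) (deriv (profile a b (hOne h))) (Ioo (-h) h) := by
    intro y hy
    apply Filter.EventuallyEq.deriv_eq
    filter_upwards [Ioo_mem_nhds hy.1 hy.2] with z hz using heq z hz
  have hcg : Continuous (deriv g) := hg.continuous_deriv le_rfl
  have hcP : Continuous (deriv (profile a b (hOne h))) := by
    rw [deriv_profile]; fun_prop
  have hcl : EqOn (deriv g) (deriv (profile a b (hOne h))) (Icc (-h) h) := by
    have := hD.closure hcg hcP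
    rwa [closure_Ioo (by linarith : (-h) ≠ h)] at this
  have h1 : deriv g h = deriv (profile a b (hOne h)) h := hcl ⟨by linarith, le_rfl⟩
  have h2 : deriv g (-h) = deriv (profile a b (hOne h)) (-h) := hcl ⟨le_rfl, by linarith⟩
  have h3 : deriv g (-h) = deriv g h := by
    have hfun : (fun y => g (y + 2 * h)) = g := funext hper
    have := deriv_comp_add_const (f := g) (a := 2 * h) (x := -h)
    rw [hfun] at this
    rw [this]; congr 1; ring
  have h4 : deriv (profile a b (hOne h)) (-h) = -deriv (profile a b (hOne h)) h := by
    rw [deriv_profile]; ring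
  apply hslope
  linarith [h1, h2, h3, h4]

/-- Property 3 for the paper's worked case `a = 1, b = 1/5, h = 1` (eq. (27) print p.9): the
profile `(1 − y²/1.21) + 0.2(1 − y⁴/1.4641)` is positive on `[−1, 1]`. [cite: Dou2026b, eq. (27) print p.9; property 3 print p.5] -/
theorem profile_pos_example : ∀ y ∈ Icc (-(1 : ℝ)) 1, 0 < profile 1 (1 / 5) (hOne 1) y := by
  intro y hy
  have hy2 : y ^ 2 ≤ 1 := by nlinarith [hy.1, hy.2]
  have hy4 : y ^ 4 ≤ 1 := by nlinarith [hy2, sq_nonneg y]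
  simp only [profile, hOne]
  norm_num
  nlinarith [hy2, hy4]

/-- **The printed property 4 fails** (Step 2 of the skeleton): witness `a = 1, b = 1/5, h = 1`.
[cite: Dou2026b, §3.2.1 property 4 print p.5] -/
theorem not_Step2_dataInClass : ¬ Step2_dataInClass := fun h2 =>
  no_periodicC1_extension one_pos (slope_ne_zero one_pos profile_pos_example)
    (h2 1 (1 / 5) 1 one_pos profile_pos_example)

/-- **VACUITY CERTIFICATE: Theorem 6.2 (as printed, rendered class) holds for every threshold —
because no field of the class has the printed initial values.** [cite: Dou2026b, Theorem 6.2 print p.12–13] -/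
theorem claimedTheorem_vacuous (Recr : ℝ) : ClaimedTheorem Recr := by
  intro ν h Lx a b pdrop _ hh hLx hpos _ hex
  obtain ⟨u, p, hsol⟩ := hex
  exact no_periodicC1_extension hh (slope_ne_zero hh hpos) (dataInClass_of_solution hh hLx hsol)

/-! ## The Couette witness against EVMP (Theorem 5.3, print p.9–10) and LocalVanishing (Theorem 6.1 item 1, print p.11) — adopted from typist-3 g2's kit v2 -/

open Literature.Analysis.FluidPDE in
/-- Plane Couette shear `L x = x₁ e₀` as a continuous linear map. [folklore] -/
def couette : EuclideanSpace ℝ (Fin 3) →L[ℝ] EuclideanSpace ℝ (Fin 3) :=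
  (EuclideanSpace.proj (1 : Fin 3)).smulRight (EuclideanSpace.single (0 : Fin 3) (1 : ℝ))

/-- `L x = x₁ e₀`. [folklore] -/
theorem couette_apply (x : EuclideanSpace ℝ (Fin 3)) :
    couette x = x 1 • EuclideanSpace.single (0 : Fin 3) (1 : ℝ) := rfl

/-- `L (L x) = 0` (the shear direction is transverse to the gradient direction). [folklore] -/
theorem couette_sq (x : EuclideanSpace ℝ (Fin 3)) : couette (couette x) = 0 := by
  rw [couette_apply, couette_apply, PiLp.smul_apply]
  simp

open Literature.Analysis.FluidPDE in
/-- `div L = tr L = 0`. [folklore] -/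
theorem couette_divFree :
    VectorCalculus.IsDivFree (couette : EuclideanSpace ℝ (Fin 3) → EuclideanSpace ℝ (Fin 3)) := by
  intro x
  rw [divergence_clm_apply, LinearMap.trace_eq_sum_inner _ (EuclideanSpace.basisFun (Fin 3) ℝ)]
  simp [Fin.sum_univ_three, couette_apply, EuclideanSpace.inner_single_left]

/-- `L e₁ = e₀ ≠ 0`. [folklore] -/
theorem couette_e1_ne_zero : couette (EuclideanSpace.single (1 : Fin 3) (1 : ℝ)) ≠ 0 := by
  rw [couette_apply]
  intro h
  have := congrArg (fun v : EuclideanSpace ℝ (Fin 3) => v 0) h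
  simp at this

open Literature.Analysis.FluidPDE in
/-- **Plane Couette flow is a steady classical Navier–Stokes solution** on any time set, with zero
pressure and zero force: `∂ₜu = 0`, `(u·∇)u = L(Lx) = 0`, `Δu = 0`, `∇p = 0`. [folklore] -/
theorem couette_isClassical (S : Set ℝ) (ν : ℝ) :
    IsClassicalNSSolutionOn S ν (fun _ _ => (0 : EuclideanSpace ℝ (Fin 3)))
      (fun _ => (couette : EuclideanSpace ℝ (Fin 3) → EuclideanSpace ℝ (Fin 3))) (fun _ _ => (0 : ℝ)) where
  smooth_velocity := (contDiff_uncurry_const_clm couette).contDiffOn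
  smooth_pressure := contDiffOn_const
  momentum := by
    intro t _ x
    rw [timeDerivWithin, derivWithin_fun_const, convect_clm_apply, couette_sq, laplacian_clm_apply,
      smul_zero, gradient_fun_const]
    simp
  divFree := fun _ _ => couette_divFree

open Literature.Analysis.FluidPDE in
/-- **EVMP (Theorem 5.3, in the generality its proof argues) is false**: at `x = e₁` the Couette
flow has `u ≠ 0`, `∂ₜu = 0` and `νΔu + ⟨f,τ⟩τ = 0`. [cite: Dou2026b, Theorem 5.3 eqs. (28)–(33) print p.9–10] -/
theorem not_Step6_EVMP : ¬ Step6_EVMP := by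
  intro h6
  have hsol := couette_isClassical (Set.univ) 1
  have hx := couette_e1_ne_zero
  refine hx (h6 Set.univ 1 _ _ _ one_pos hsol 0 (Set.mem_univ _)
    (EuclideanSpace.single (1 : Fin 3) (1 : ℝ)) hx ?_ ?_)
  · rw [timeDerivWithin, derivWithin_fun_const]; rfl
  · rw [laplacian_clm_apply, smul_zero, inner_zero_left, zero_smul, add_zero]

open Literature.Analysis.FluidPDE in
/-- **LocalVanishing (Theorem 6.1 item 1, (38), general form) is false**: for the Couette flow
`νΔu + f ≡ 0`, so the local H¹-energy is identically `0` (hence tends to `0`), `∂ₜu = 0`, yet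
`u(e₁) ≠ 0`. [cite: Dou2026b, Theorem 6.1 proof item 1 eq. (38) print p.11] -/
theorem not_LocalVanishing : ¬ LocalVanishing := by
  intro hLV
  have hsol := couette_isClassical (Set.Ici 0) 1
  have hx := couette_e1_ne_zero
  have hS : (fun t : ℝ => h1LocalSq (fun x => (1 : ℝ) • (Δ ((fun _ : ℝ =>
      (couette : EuclideanSpace ℝ (Fin 3) → EuclideanSpace ℝ (Fin 3))) t)) x +
      (fun _ _ => (0 : EuclideanSpace ℝ (Fin 3))) t x) (EuclideanSpace.single (1 : Fin 3) (1 : ℝ)) 1)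
      = fun _ => 0 := by
    funext t
    have hz : (fun x => (1 : ℝ) • (Δ ((fun _ : ℝ =>
        (couette : EuclideanSpace ℝ (Fin 3) → EuclideanSpace ℝ (Fin 3))) t)) x +
        (fun _ _ => (0 : EuclideanSpace ℝ (Fin 3))) t x) = fun _ => 0 := by
      funext x; rw [laplacian_clm_apply]; simp
    rw [hz, h1LocalSq]
    simp
  have hlim : Tendsto (fun t : ℝ => h1LocalSq (fun x => (1 : ℝ) • (Δ ((fun _ : ℝ =>
      (couette : EuclideanSpace ℝ (Fin 3) → EuclideanSpace ℝ (Fin 3))) t)) x +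
      (fun _ _ => (0 : EuclideanSpace ℝ (Fin 3))) t x) (EuclideanSpace.single (1 : Fin 3) (1 : ℝ)) 1)
      (𝓝[<] (1 : ℝ)) (𝓝 0) := by
    rw [hS]; exact tendsto_const_nhds
  have hdt : timeDerivWithin (Set.Ici 0) (fun _ : ℝ =>
      (couette : EuclideanSpace ℝ (Fin 3) → EuclideanSpace ℝ (Fin 3))) 1
      (EuclideanSpace.single (1 : Fin 3) (1 : ℝ)) = 0 := by
    rw [timeDerivWithin, derivWithin_fun_const]; rfl
  exact hx (hLV 1 _ _ _ one_pos hsol 1 one_pos (EuclideanSpace.single (1 : Fin 3) (1 : ℝ)) 1 one_pos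
    hlim hdt _ (Metric.mem_ball_self one_pos))


/-! ## Step 4e (Theorem 5.1 proof item 5, print p.8): pointwise vanishing does not force the local H¹-energy to vanish -/

open MeasureTheory in
/-- The local `H¹(B_ε(0))`-energy of the identity field is at least the volume of the ball, hence
positive. [folklore] -/
theorem h1LocalSq_id_pos {ε : ℝ} (hε : 0 < ε) :
    0 < h1LocalSq (fun x : EuclideanSpace ℝ (Fin 3) => x) 0 ε := by
  have hvol : 0 < (volume (Metric.ball (0 : EuclideanSpace ℝ (Fin 3)) ε)).toReal :=
    ENNReal.toReal_pos (Metric.measure_ball_pos volume _ hε).ne' measure_ball_lt_top.ne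
  have hint : ∀ x : EuclideanSpace ℝ (Fin 3),
      ‖(fun x : EuclideanSpace ℝ (Fin 3) => x) x‖ ^ 2
        + ‖fderiv ℝ (fun x : EuclideanSpace ℝ (Fin 3) => x) x‖ ^ 2 = ‖x‖ ^ 2 + 1 := by
    intro x
    rw [fderiv_fun_id, ContinuousLinearMap.norm_id, one_pow]
  unfold h1LocalSq
  simp_rw [hint]
  have hcont : Continuous fun x : EuclideanSpace ℝ (Fin 3) => ‖x‖ ^ 2 + 1 := by fun_prop
  have hI : IntegrableOn (fun x : EuclideanSpace ℝ (Fin 3) => ‖x‖ ^ 2 + 1) (Metric.ball 0 ε) volume :=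
    (hcont.continuousOn.integrableOn_compact (isCompact_closedBall 0 ε)).mono_set
      Metric.ball_subset_closedBall
  have h1 : IntegrableOn (fun _ : EuclideanSpace ℝ (Fin 3) => (1 : ℝ)) (Metric.ball 0 ε) volume :=
    (continuous_const.continuousOn.integrableOn_compact (isCompact_closedBall 0 ε)).mono_set
      Metric.ball_subset_closedBall
  calc (0 : ℝ) < (volume (Metric.ball (0 : EuclideanSpace ℝ (Fin 3)) ε)).toReal := hvol
    _ = ∫ _ in Metric.ball (0 : EuclideanSpace ℝ (Fin 3)) ε, (1 : ℝ) := by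
      rw [setIntegral_const, smul_eq_mul, mul_one, measureReal_def]
    _ ≤ ∫ x in Metric.ball (0 : EuclideanSpace ℝ (Fin 3)) ε, (‖x‖ ^ 2 + 1) :=
      setIntegral_mono h1 hI fun x => by simp only; nlinarith [sq_nonneg ‖x‖]

/-- **Theorem 5.1 proof item 5 (general form `Step4e_pointwiseToH1`) is false**: the field
`S(t,x) = x` is `C¹`, vanishes at `x* = 0` at every time, yet its local `H¹(B_1(0))`-energy is a
positive constant and does not tend to `0`. [cite: Dou2026b, Theorem 5.1 proof item 5 print p.8] -/
theorem not_Step4e_pointwiseToH1 : ¬ Step4e_pointwiseToH1 := by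
  intro h4e
  have h := h4e (fun (_ : ℝ) (x : EuclideanSpace ℝ (Fin 3)) => x) 0 0 contDiff_snd rfl 1 one_pos
  have hc : h1LocalSq (fun x : EuclideanSpace ℝ (Fin 3) => x) 0 1 = 0 :=
    tendsto_nhds_unique tendsto_const_nhds h
  exact (h1LocalSq_id_pos one_pos).ne' hc

end Summit.NavierStokesRegularity.NavierStokesRegularity.Theorems.Dou2026b

end

-- WHAT THIS IS NOT: not a claim about NS regularity or blow-up; not a claim about any author beyond the typed locator.
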